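import Mathlib
import Summits.Ventures.PercRepro2.HCov
import Summits.Ventures.PercRepro2.BHKOutside
import Summits.Ventures.PercRepro2.ISplit

/-!
# `P(b ∈ C₂ | T) ≥ P(b ∈ C₂ | PD)` is a theorem (blind cell PercRepro2, p5 g22; `proofs/P5-OEDGE.md` §28 (4))

With `R = {a₁ ↮ a₂, a₃} = PD ⊔ T` (`avoidAll a₁ {a₂, a₃}`), the two events `a₃ ∈ C₂` and `b ∈ C₂` are
increasing events of the cluster of `a₂` OFF `C₁`; conditionally on `R` they are positively correlated
(BHK06, `bhk_two_outside_avoid` with `s = a₁`, `u = v = a₂`, `X = {a₂, a₃}`):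

  `P(R, a₃ ∈ C₂) · P(R, b ∈ C₂) ≤ P(R, a₃ ∈ C₂, b ∈ C₂) · P(R)`,

and since `R ∩ {a₃ ∈ C₂} = T`, `P(R) = P(PD) + P(T)`, `P(R, b ∈ C₂) = P(PD, b ∈ C₂) + P(T, b ∈ C₂)`, this is

  **`T_bH_dominates_PD`: `P(T) · P(PD, b ∈ C₂) ≤ P(PD) · P(T, b ∈ C₂)`** — the candidate of §28 (4)
  (90/90, four climbs best `0.0`) is a theorem, and with `PendantK1.K1_of_T_dominates_PD` the first half
  `(K1)` of the pendant-root condition `(K)` is unconditional.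
-/

namespace Summit.Ventures.PercRepro2

open UnionCluster

namespace CovForm

namespace FirstOrder

section Sets

variable {V : Type*} {E : Type*} [DecidableEq V]

/-- `{a₃ ∈ C₂} ∩ {a₁ ↮ a₂, a₃} = T`. -/
lemma clusterIn_a3_inter_avoid_eq_TEvent (ends : E → Sym2 V) (a₁ a₂ a₃ : V) :
    clusterInEvent ends a₂ {W | a₃ ∈ W} ∩ avoidAll ends a₁ {a₂, a₃} = TEvent ends a₁ a₂ a₃ := by
  ext ω
  simp only [TEvent, Set.mem_inter_iff, Set.mem_compl_iff, mem_connEvent, mem_clusterInEvent,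
    Set.mem_setOf_eq, mem_cluster, mem_avoidAll, Finset.mem_insert, Finset.mem_singleton,
    forall_eq_or_imp, forall_eq]
  constructor
  · rintro ⟨h23, h12, _⟩
    exact ⟨fun h21 => h12 (conn_symm h21), h23⟩
  · rintro ⟨h21, h23⟩
    exact ⟨h23, fun h12 => h21 (conn_symm h12), fun h13 => h21 (conn_symm (conn_trans h13 (conn_symm h23)))⟩

/-- `{a₃ ∈ C₂} ∩ {b ∈ C₂} ∩ {a₁ ↮ a₂, a₃} = T ∩ {b ∈ C₂}`. -/
lemma clusterIn_a3_b_inter_avoid_eq (ends : E → Sym2 V) (a₁ a₂ a₃ b : V) :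
    clusterInEvent ends a₂ {W | a₃ ∈ W} ∩ clusterInEvent ends a₂ {W | b ∈ W} ∩
        avoidAll ends a₁ {a₂, a₃} =
      TEvent ends a₁ a₂ a₃ ∩ connEvent ends a₂ b := by
  rw [Set.inter_assoc, Set.inter_comm (clusterInEvent ends a₂ {W | b ∈ W}), ← Set.inter_assoc,
    clusterIn_a3_inter_avoid_eq_TEvent, ← connEvent_eq_clusterInEvent]

end Sets

section Main

variable {V : Type*} {E : Type*} [Fintype E] [DecidableEq E] [Fintype V] [DecidableEq V]
  {R : Type*} [Field R] [LinearOrder R] [IsStrictOrderedRing R]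

/-- **`P(T) · P(PD, b ∈ C₂) ≤ P(PD) · P(T, b ∈ C₂)`**, i.e. `P(b ∈ C₂ | PD) ≤ P(b ∈ C₂ | T)`
(`bhk_two_outside_avoid`, `s = a₁`, `u = v = a₂`, `X = {a₂, a₃}`, `𝓤 = {a₃ ∈ ·}`, `𝓥 = {b ∈ ·}`). -/
theorem T_bH_dominates_PD (p : E → R) (hp : IsProbVec p) (ends : E → Sym2 V) (a₁ a₂ a₃ b : V) :
    prob p (TEvent ends a₁ a₂ a₃) * prob p (PDEvent ends a₁ a₂ a₃ ∩ connEvent ends a₂ b) ≤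
      prob p (PDEvent ends a₁ a₂ a₃) * prob p (TEvent ends a₁ a₂ a₃ ∩ connEvent ends a₂ b) := by
  classical
  have h := bhk_two_outside_avoid p hp ends a₁ a₂ a₂ ({a₂, a₃} : Finset V)
    (isUpperSet_mem_setOf a₃) (isUpperSet_mem_setOf b)
  have hins : insert a₂ ({a₂, a₃} : Finset V) = {a₂, a₃} :=
    Finset.insert_eq_of_mem (Finset.mem_insert_self a₂ {a₃})
  rw [hins, hins, clusterIn_a3_inter_avoid_eq_TEvent, clusterIn_a3_b_inter_avoid_eq,
    ← connEvent_eq_clusterInEvent ends a₂ b] at h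
  have hR := ISplit.prob_PD_add_T p ends a₁ a₂ a₃ Set.univ
  simp only [Set.inter_univ] at hR
  have hb := ISplit.prob_PD_add_T p ends a₁ a₂ a₃ (connEvent ends a₂ b)
  rw [Set.inter_comm (connEvent ends a₂ b), ← hb, ← hR] at h
  nlinarith [h]

end Main

end FirstOrder

end CovForm

end Summit.Ventures.PercRepro2
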